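import Mathlib
import HarnessLib
import Literature.Computability.Complexity.CNF
import Literature.Computability.Complexity.PNPWave0
import Literature.Computability.Complexity.KSATReductions
import Literature.Computability.Complexity.LexCompareBricks
import Literature.Computability.Complexity.TimeBounds
import Summits.PneNP.PneNP.Theorems.OverlapGapAlgebraSearchHardWindowRequotPolyTime

/-!
# PneNP / OverlapGapAlgebra — `SearchHardWindow`, line `IdeaSketch_r2_k6`: the first-literal
# truncation transcoder is polynomial time

Support for crux `stmt-PneNP-2460` (`Summit.PneNP.PneNP.Theses.OverlapGapAlgebra.SearchHardWindow`),
line `IdeaSketch_r2_k6` (exact self-couplings), stub `stub_retruncPolyTime`.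

The line transports hardness along the coupling `F_{k+1}(n, m) → F_k(n, m)` that deletes the first
literal of every clause; at word level this needs a polynomial-time `t : List Bool → List Bool`
with `t (encodingCNF.encode L) = encodingCNF.encode (L.map List.tail)` for every clause list `L`.

The transcoder is the explicit brick term
`CanonCode.canonListFnC 26 (KSATRed.canonClauseFn ∘ Brick.fanoutFn (LexCmp.tailFn ∘ Brick.fstF) (Brick.sndF ∘ Brick.sndF))`:
the clipped list loop of `CanonicalCodes.lean` over the clause codes, with the item map "raw tail,
then canonical re-encoding". The raw tail `u ↦ ⟨(fst u).tail, snd (snd u)⟩` satisfies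
`decClause (rawTail u) = (decClause u).tail` for EVERY string `u` (`shwQT_decClause_rawTail`; the
clause decoder reads `|fst u|` literals off `snd u`), so the item map is
`u ↦ encodingClause.encode ((decClause u).tail)` (`shwQT_item_eq`), linearly bounded
(`|·| ≤ 8 |u| + 18`, `shwQT_length_item_le`), and `CanonCode.canonListFnC_apply` /
`CanonCode.foldr_decList` (with `shwQR_decList_comp` of the sibling file `…RequotPolyTime`:
`decList (g ∘ d) = map g ∘ decList d`) give `t w = encodingCNF.encode ((decCNF w).map List.tail)`
for every `w` (`shwQT_retrunc_apply`); on a code `w = encodingCNF.encode L`, `decCNF w = L`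
(`KSATRed.decCNF_encode`). Membership in `FP` is brick closure (`shwQT_retrunc_mem_FP`), and
`IsPolyTime` is `FP` through `polyTimeComputable_iff_nonempty`.

No definitions; axioms `propext`, `Classical.choice`, `Quot.sound`.
-/

set_option linter.dupNamespace false -- `Summit.PneNP.PneNP.…`: summit = sub-problem (D-0017)

namespace Summit.PneNP.PneNP.Theorems

open _root_.Computability Literature.Computability.Complexity Brick CanonCode NegCNF KSATRed LexCmp

/-- Value of the raw tail map on clause codes: `u ↦ ⟨(fst u).tail, snd (snd u)⟩`. [folklore] -/
theorem shwQT_rawTail_apply (u : List Bool) :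
    fanoutFn (tailFn ∘ fstF) (sndF ∘ sndF) u =
      boolPair (boolUnpair u).1.tail (boolUnpair (boolUnpair u).2).2 := by
  simp [fstF, sndF]

/-- **The raw tail deletes the first literal of the decoded clause**, on every string: the clause
decoder reads `|fst u|` literals off `snd u`, so shortening the header by one and skipping the
first item reads exactly the remaining literals. [folklore] -/
theorem shwQT_decClause_rawTail (u : List Bool) :
    decClause (fanoutFn (tailFn ∘ fstF) (sndF ∘ sndF) u) = (decClause u).tail := by
  rw [shwQT_rawTail_apply]
  simp only [decClause, boolUnpair_boolPair]
  generalize (boolUnpair u).1 = hd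
  cases hd with
  | nil => rfl
  | cons b l => rfl

/-- The raw tail map lengthens by at most `2`: `|⟨(fst u).tail, snd (snd u)⟩| ≤ |u| + 2`.
[folklore] -/
theorem shwQT_length_rawTail_le (u : List Bool) :
    (fanoutFn (tailFn ∘ fstF) (sndF ∘ sndF) u).length ≤ u.length + 2 := by
  rw [shwQT_rawTail_apply, length_boolPair, List.length_tail]
  have h1 := length_boolUnpair_parts_le u
  have h2 := length_boolUnpair_parts_le (boolUnpair u).2
  omega

/-- **The item map re-encodes the tail of the decoded clause**:
`canonClauseFn (rawTail u) = encodingClause.encode ((decClause u).tail)` for every `u`. [folklore] -/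
theorem shwQT_item_eq (u : List Bool) :
    (canonClauseFn ∘ fanoutFn (tailFn ∘ fstF) (sndF ∘ sndF)) u =
      encodingClause.encode ((List.tail ∘ decClause) u) := by
  rw [Function.comp_apply, Function.comp_apply, canonClauseFn_eq, shwQT_decClause_rawTail]

/-- The item map is linearly bounded: `|canonClauseFn (rawTail u)| ≤ 8 |u| + 18`. [folklore] -/
theorem shwQT_length_item_le (u : List Bool) :
    ((canonClauseFn ∘ fanoutFn (tailFn ∘ fstF) (sndF ∘ sndF)) u).length ≤ 8 * u.length + 18 := by
  have h1 := length_canonClauseFn_le (fanoutFn (tailFn ∘ fstF) (sndF ∘ sndF) u)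
  have h2 := shwQT_length_rawTail_le u
  rw [Function.comp_apply]
  omega

/-- **The truncation transcoder is in `FP`** (brick closure: `canonListFnC_mem_FP`,
`canonClauseFn_mem_FP`, `fanoutFn_mem_FP`, `tailFn_mem_FP`, projections). [folklore] -/
theorem shwQT_retrunc_mem_FP :
    canonListFnC 26 (canonClauseFn ∘ fanoutFn (tailFn ∘ fstF) (sndF ∘ sndF)) ∈ FP :=
  canonListFnC_mem_FP 26 (comp_mem_FP canonClauseFn_mem_FP
    (fanoutFn_mem_FP (comp_mem_FP tailFn_mem_FP fstF_mem_FP) (comp_mem_FP sndF_mem_FP sndF_mem_FP)))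

/-- **Value of the truncation transcoder on every string**: the code of the decoded CNF with the
first literal of every clause deleted. [folklore] -/
theorem shwQT_retrunc_apply (w : List Bool) :
    canonListFnC 26 (canonClauseFn ∘ fanoutFn (tailFn ∘ fstF) (sndF ∘ sndF)) w =
      encodingCNF.encode ((decCNF w).map List.tail) := by
  rw [canonListFnC_apply (C := 26) shwQT_length_item_le (by norm_num), decCNF,
    ← shwQR_decList_comp decClause List.tail]
  simp only [encodingCNF, Encoding.listBool, length_decList,
    foldr_decList encodingClause (List.tail ∘ decClause) shwQT_item_eq]

/-- **The first-literal truncation transcoder is polynomial time**: a poly-time word function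
sending the `encodingCNF`-code of any clause list `L` to the code of `L.map List.tail`
(stub `stub_retruncPolyTime` of line `IdeaSketch_r2_k6`, crux `stmt-PneNP-2460`). [folklore] -/
theorem stub_retruncPolyTime :
    ∃ t : List Bool → List Bool, IsPolyTime t ∧ ∀ L : List (List (ℕ × Bool)),
      t (encodingCNF.encode L) = encodingCNF.encode (L.map List.tail) :=
  ⟨canonListFnC 26 (canonClauseFn ∘ fanoutFn (tailFn ∘ fstF) (sndF ∘ sndF)),
    polyTimeComputable_iff_nonempty.1 shwQT_retrunc_mem_FP,
    fun L => by rw [shwQT_retrunc_apply, decCNF_encode]⟩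

end Summit.PneNP.PneNP.Theorems
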